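import Summits.ResolutionOfSingularities.ResolutionOfSingularities.Theorems.EquisingularLiftEquisingularLiftNatPointTail
import Summits.ResolutionOfSingularities.ResolutionOfSingularities.Theorems.EquisingularLiftEquisingularLiftNatHorizChain
import Summits.ResolutionOfSingularities.ResolutionOfSingularities.Theorems.EquisingularLiftEquisingularLiftProjectiveAmbientIntegralFibre
import Summits.ResolutionOfSingularities.ResolutionOfSingularities.Theorems.EquisingularLiftEquisingularLiftNatLinearCentre
import HarnessLib

/-!
# [OURS · L1 W4.5(b) · EL♮] RUNG T-Δ-ISO «ONE Δ-STEP THEN POINTS» — the assembly (res-L1-w45b-lead-2 TARGETS 2026-08-27T06:52:51Z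
# (3); named to res-D-pv-013 by res-L1-w45b-plan-1 CHAIN v7.1 (B) 06:58:56Z)

Crux `EquisingularLiftNat` = stmt-ResolutionOfSingularities-20038 (route EquisingularLift), line `sections`; helper file
`--supports … --as helper`. HONEST FRAMING: OURS (cell res-hironaka, slot W4.5(b)); NOT a statement of any manuscript. AI-written,
weaker than expert review. No `sorry`; standard axioms.

THE RUNG (lead-2's words): «H ⊂ ℙ³_k integral with an isolated singular point P such that for some plane curve Z ⊆ H₁ ∩ E the
strict transform of H under Bl_P then Bl_Z is resolved by finitely many SURFACE point blow-ups ⇒ the horizontal form of EL♮ holds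
for H» = section step + T-CARRIER-Δ centre + multisections + R0 + ASSEMBLY. This file is the ∃-FORM ASSEMBLY (no CAS, any `n`):

* `horizChainE1_of_twoSteps_pointResolvable` — SETTING of p500485 / `pointStep`: `O` a DVR, `q : P → Spec O` smooth proper,
  `Y ⊆ q⁻¹{s₀}` closed irreducible. GIVEN two EXPLICIT horizontal E1 steps — a level-0 step `(C₁, τ₁ : X₁ → P)` out of `(P, 𝟙, Y)`
  (the section through `P`, or any regular `O`-flat centre: e.g. res-D-pv-013's `linearCentre_stepData`, p505964) and a level-1 step
  `(C₂, τ₂ : X₂ → X₁)` out of `(X₁, τ₁, S₁)`, `S₁ = closure τ₁⁻¹(Y ∖ V(C₁))` (the Δ-centre in the point-carrier: res-type-100's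
  T-CARRIER-Δ delivers its five step clauses) — the multisection DEVICE (MS) of `horizChainE1_of_pointResolvable` (T-TAIL, p508794;
  res-D-pv-003's T-MULTISEC discharges it) and POINT-RESOLVABILITY of a scheme `Γ ≅ V(closure S₂)_red` (the specimen's downstairs
  chart computation, e.g. `Γ = Bl_Z Bl_P H`), some stage of the horizontal-E1 closure of `(P, 𝟙, Y)` has REGULAR reduced strict
  transform. Proof: two applications of the step clause, then T-TAIL.
* `elNatBody_of_twoSteps_pointResolvable` — the same in the ITEM's `q`-spelling (`P = ℙⁿ_O = Proj O[x₀..xₙ]`,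
  `Y = (ι ≫ Proj.map φ)(H)`): conclusion = the `∃ (P′, σ, S′)` body of `Theorems.EquisingularLift.ELNatOver` (item E1-chain ∧
  irreducible special fibre ∧ regular reduced strict transform), via `natChain_and_isIrreducible_of_horizChainE1` (p500485).

References: …NatPointTail.lean (p508794), …NatPointStep.lean (p505032), …NatOneStep.lean (p505461), …NatHorizChain.lean (p500485);
res-L1-w45b-lead-2 TARGETS 06:52:51Z / MEMO-2 v1.3 §7; res-L1-w45b-plan-1 CHAIN v7.1 — OURS planning texts, index only.
-/

set_option linter.dupNamespace false -- mandated namespace `Summit.<Summit>.<Problem>` of this single-conjunct summit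
set_option linter.overlappingInstances false -- signatures carry `[IsDomain O] [IsDiscreteValuationRing O]`

noncomputable section

open CategoryTheory CategoryTheory.Limits AlgebraicGeometry TopologicalSpace Topology
open MvPolynomial
open Literature.AlgebraicGeometry.Resolution
open AlgebraicGeometry.Scheme.IdealSheafData
open Summit.ResolutionOfSingularities.ResolutionOfSingularities.Theses.EquisingularLift.Split
open Summit.ResolutionOfSingularities.ResolutionOfSingularities.Cruxes.EquisingularLift.StrataSplit

attribute [local instance] MvPolynomial.gradedAlgebra

namespace Summit.ResolutionOfSingularities.ResolutionOfSingularities.Cruxes.EquisingularLiftNat.Sections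

/-! ## Two explicit steps, then the tail -/

/-- **T-Δ-ISO, general base.** Two explicit horizontal E1 steps `(C₁, τ₁)` (level 0) and `(C₂, τ₂)` (level 1), the multisection
device (MS) of T-TAIL, and point-resolvability of `Γ ≅ V(closure S₂)_red` give a stage of the horizontal-E1 closure of `(P, 𝟙, Y)`
with regular reduced strict transform. [folklore; assembly of p508794] -/
theorem horizChainE1_of_twoSteps_pointResolvable (O : Type) [CommRing O] [IsDomain O] [IsDiscreteValuationRing O]
    (P : Scheme.{0}) (q : P ⟶ Spec (.of O)) (Y : Closeds P) (hq : Smooth q) (hqp : IsProper q)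
    (hY : (Y : Set P) ⊆ q ⁻¹' {IsLocalRing.closedPoint O}) (hYirr : IsIrreducible (Y : Set P))
    -- step 1 (level 0)
    (C₁ : P.IdealSheafData) (X₁ : Scheme.{0}) (τ₁ : X₁ ⟶ P) (hτ₁ : IsBlowup τ₁ C₁) (hC₁reg : Scheme.IsRegular C₁.subscheme)
    (hC₁flat : Flat (C₁.subschemeι ≫ 𝟙 P ≫ q))
    (hC₁gen : (𝟙 P : P ⟶ P) '' (C₁.support : Set P) ⊆ {x : P | ¬ IsGenericPoint x (Y : Set P)})
    (hC₁E1 : (C₁.support : Set P) ∩ (𝟙 P ≫ q) ⁻¹' {IsLocalRing.closedPoint O} ⊆ (Y : Set P))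
    -- step 2 (level 1), `S₁ = closure τ₁⁻¹(Y ∖ V(C₁))`
    (C₂ : X₁.IdealSheafData) (X₂ : Scheme.{0}) (τ₂ : X₂ ⟶ X₁) (hτ₂ : IsBlowup τ₂ C₂) (hC₂reg : Scheme.IsRegular C₂.subscheme)
    (hC₂flat : Flat (C₂.subschemeι ≫ τ₁ ≫ q))
    (hC₂gen : τ₁ '' (C₂.support : Set X₁) ⊆ {x : P | ¬ IsGenericPoint x (Y : Set P)})
    (hC₂E1 : (C₂.support : Set X₁) ∩ (τ₁ ≫ q) ⁻¹' {IsLocalRing.closedPoint O} ⊆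
      closure (τ₁ ⁻¹' ((Y : Set P) \ (C₁.support : Set P))))
    -- the multisection device and its admissibility predicate
    (Adm : ∀ Γ : Scheme.{0}, Γ → Prop)
    (hAdm : ∀ (Γ Γ' : Scheme.{0}) (e : Γ ≅ Γ') (x : Γ), Adm Γ x → Adm Γ' (e.hom x))
    (hMS : ∀ (X' : Scheme.{0}) (σ' : X' ⟶ P) (S' : Set X'),
      (∀ Q : (∀ X' : Scheme.{0}, (X' ⟶ P) → Set X' → Prop), Q P (𝟙 P) (Y : Set P) →
        (∀ (X' X'' : Scheme.{0}) (σ' : X' ⟶ P) (Y' : Set X') (C : X'.IdealSheafData) (τ : X'' ⟶ X'),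
          Q X' σ' Y' → IsBlowup τ C → Scheme.IsRegular C.subscheme → Flat (C.subschemeι ≫ σ' ≫ q) →
          σ' '' (C.support : Set X') ⊆ {x | ¬ IsGenericPoint x (Y : Set P)} →
          (C.support : Set X') ∩ (σ' ≫ q) ⁻¹' {IsLocalRing.closedPoint O} ⊆ Y' →
          Q X'' (τ ≫ σ') (closure (τ ⁻¹' (Y' \ (C.support : Set X'))))) → Q X' σ' S') →
      IsLocallyNoetherian X' → Scheme.IsRegular X' → IsProper (σ' ≫ q) →
      ∀ (z : ↥(vanishingIdeal (⟨closure S', isClosed_closure⟩ : Closeds X')).subscheme),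
        IsClosed ({((vanishingIdeal (⟨closure S', isClosed_closure⟩ : Closeds X')).subschemeι z : X')} : Set X') →
        ¬ IsRegularLocalRing ((vanishingIdeal (⟨closure S', isClosed_closure⟩ : Closeds X')).subscheme.presheaf.stalk z) →
        Adm _ z →
        ∃ C : X'.IdealSheafData, Scheme.IsRegular C.subscheme ∧ Flat (C.subschemeι ≫ σ' ≫ q) ∧
          (C.support : Set X') ∩ (σ' ≫ q) ⁻¹' {IsLocalRing.closedPoint O} =
            {((vanishingIdeal (⟨closure S', isClosed_closure⟩ : Closeds X')).subschemeι z : X')} ∧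
          ∃ hzc : IsClosed ({z} : Set ↥(vanishingIdeal (⟨closure S', isClosed_closure⟩ : Closeds X')).subscheme),
            C.comap (vanishingIdeal (⟨closure S', isClosed_closure⟩ : Closeds X')).subschemeι = vanishingIdeal ⟨{z}, hzc⟩)
    -- the downstairs scheme after the two steps and its point-resolvability
    (Γ : Scheme.{0})
    (e : Γ ≅ (vanishingIdeal (⟨closure (closure (τ₂ ⁻¹' (closure (τ₁ ⁻¹' ((Y : Set P) \ (C₁.support : Set P))) \
      (C₂.support : Set X₁)))), isClosed_closure⟩ : Closeds X₂)).subscheme)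
    (hres : ∃ Γs : Scheme.{0}, (∀ R : Scheme.{0} → Prop, R Γ →
      (∀ (Γ₁ Γ₂ : Scheme.{0}) (x : Γ₁) (hx : IsClosed ({x} : Set Γ₁)) (υ : Γ₂ ⟶ Γ₁), R Γ₁ →
        ¬ IsRegularLocalRing (Γ₁.presheaf.stalk x) → Adm Γ₁ x → IsBlowup υ (vanishingIdeal ⟨{x}, hx⟩) → R Γ₂) → R Γs) ∧
      Scheme.IsRegular Γs) :
    ∃ (P' : Scheme.{0}) (σ : P' ⟶ P) (S' : Set P'),
      (∀ Q : (∀ X' : Scheme.{0}, (X' ⟶ P) → Set X' → Prop), Q P (𝟙 P) (Y : Set P) →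
        (∀ (X' X'' : Scheme.{0}) (σ' : X' ⟶ P) (Y' : Set X') (C : X'.IdealSheafData) (τ : X'' ⟶ X'),
          Q X' σ' Y' → IsBlowup τ C → Scheme.IsRegular C.subscheme → Flat (C.subschemeι ≫ σ' ≫ q) →
          σ' '' (C.support : Set X') ⊆ {x | ¬ IsGenericPoint x (Y : Set P)} →
          (C.support : Set X') ∩ (σ' ≫ q) ⁻¹' {IsLocalRing.closedPoint O} ⊆ Y' →
          Q X'' (τ ≫ σ') (closure (τ ⁻¹' (Y' \ (C.support : Set X'))))) → Q P' σ S') ∧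
      Scheme.IsRegular (vanishingIdeal (⟨closure S', isClosed_closure⟩ : Closeds P')).subscheme := by
  classical
  -- the horizontal-E1 closure as a stage predicate
  obtain ⟨Ch, hCh⟩ : ∃ Ch : ∀ X' : Scheme.{0}, (X' ⟶ P) → Set X' → Prop,
      ∀ (X₀ : Scheme.{0}) (σ₀ : X₀ ⟶ P) (S₀ : Set X₀), Ch X₀ σ₀ S₀ ↔
      ∀ Q : (∀ X' : Scheme.{0}, (X' ⟶ P) → Set X' → Prop), Q P (𝟙 P) (Y : Set P) →
        (∀ (X' X'' : Scheme.{0}) (σ' : X' ⟶ P) (Y' : Set X') (C : X'.IdealSheafData) (τ : X'' ⟶ X'),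
          Q X' σ' Y' → IsBlowup τ C → Scheme.IsRegular C.subscheme → Flat (C.subschemeι ≫ σ' ≫ q) →
          σ' '' (C.support : Set X') ⊆ {x | ¬ IsGenericPoint x (Y : Set P)} →
          (C.support : Set X') ∩ (σ' ≫ q) ⁻¹' {IsLocalRing.closedPoint O} ⊆ Y' →
          Q X'' (τ ≫ σ') (closure (τ ⁻¹' (Y' \ (C.support : Set X'))))) → Q X₀ σ₀ S₀ := ⟨_, fun _ _ _ => Iff.rfl⟩
  have hChain : ∀ (X' : Scheme.{0}) (σ : X' ⟶ P) (S : Set X'), Ch X' σ S → Chain P (Y : Set P) X' σ S :=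
    fun X' σ S h Q h0 hs => (hCh X' σ S).mp h Q h0
      (fun X₁ X₂ σ' Y' C τ hQ hb hr _ hg' _ => hs X₁ X₂ σ' Y' C τ hQ hb hr hg')
  have hStep : ∀ (X' X'' : Scheme.{0}) (σ' : X' ⟶ P) (S' : Set X') (C : X'.IdealSheafData) (τ : X'' ⟶ X'),
      Ch X' σ' S' → IsBlowup τ C → Scheme.IsRegular C.subscheme → Flat (C.subschemeι ≫ σ' ≫ q) →
      σ' '' (C.support : Set X') ⊆ {x | ¬ IsGenericPoint x (Y : Set P)} →
      (C.support : Set X') ∩ (σ' ≫ q) ⁻¹' {IsLocalRing.closedPoint O} ⊆ S' →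
      Ch X'' (τ ≫ σ') (closure (τ ⁻¹' (S' \ (C.support : Set X')))) :=
    fun X' X'' σ' S' C τ h hb hr hfl hg' hE => (hCh _ _ _).mpr fun Q h0 hs =>
      hs X' X'' σ' S' C τ ((hCh X' σ' S').mp h Q h0 hs) hb hr hfl hg' hE
  have hCh₀ : Ch P (𝟙 P) (Y : Set P) := (hCh _ _ _).mpr fun Q h0 _ => h0
  -- the two explicit steps
  have hCh₁ : Ch X₁ (τ₁ ≫ 𝟙 P) (closure (τ₁ ⁻¹' ((Y : Set P) \ (C₁.support : Set P)))) :=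
    hStep P X₁ (𝟙 P) (Y : Set P) C₁ τ₁ hCh₀ hτ₁ hC₁reg hC₁flat hC₁gen hC₁E1
  rw [Category.comp_id] at hCh₁
  have hCh₂ : Ch X₂ (τ₂ ≫ τ₁)
      (closure (τ₂ ⁻¹' (closure (τ₁ ⁻¹' ((Y : Set P) \ (C₁.support : Set P))) \ (C₂.support : Set X₁)))) :=
    hStep X₁ X₂ τ₁ _ C₂ τ₂ hCh₁ hτ₂ hC₂reg hC₂flat hC₂gen hC₂E1
  -- the tail
  have hMS' : ∀ (X' : Scheme.{0}) (σ' : X' ⟶ P) (S' : Set X'), Ch X' σ' S' → IsLocallyNoetherian X' →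
      Scheme.IsRegular X' → IsProper (σ' ≫ q) →
      ∀ (z : ↥(vanishingIdeal (⟨closure S', isClosed_closure⟩ : Closeds X')).subscheme),
        IsClosed ({((vanishingIdeal (⟨closure S', isClosed_closure⟩ : Closeds X')).subschemeι z : X')} : Set X') →
        ¬ IsRegularLocalRing ((vanishingIdeal (⟨closure S', isClosed_closure⟩ : Closeds X')).subscheme.presheaf.stalk z) →
        Adm _ z →
        ∃ C : X'.IdealSheafData, Scheme.IsRegular C.subscheme ∧ Flat (C.subschemeι ≫ σ' ≫ q) ∧
          (C.support : Set X') ∩ (σ' ≫ q) ⁻¹' {IsLocalRing.closedPoint O} =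
            {((vanishingIdeal (⟨closure S', isClosed_closure⟩ : Closeds X')).subschemeι z : X')} ∧
          ∃ hzc : IsClosed ({z} : Set ↥(vanishingIdeal (⟨closure S', isClosed_closure⟩ : Closeds X')).subscheme),
            C.comap (vanishingIdeal (⟨closure S', isClosed_closure⟩ : Closeds X')).subschemeι = vanishingIdeal ⟨{z}, hzc⟩ :=
    fun X' σ' S' h => hMS X' σ' S' ((hCh X' σ' S').mp h)
  obtain ⟨P', σ, S', hChF, hregF⟩ := horizChainE1_of_pointResolvable O P q Y Ch hChain hStep hq hqp hY hYirr Adm hAdm hMS'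
    X₂ (τ₂ ≫ τ₁) _ hCh₂ Γ e hres
  exact ⟨P', σ, S', (hCh P' σ S').mp hChF, hregF⟩

/-! ## The item's `q`-spelling: `P = ℙⁿ_O`, `Y = (ι ≫ Proj.map φ)(H)` -/

/-- **RUNG T-Δ-ISO «ONE Δ-STEP THEN POINTS», `q`-spelling.** `O` a DVR with a surjection `π : O → k` onto a field, `ι : H → ℙⁿ_k` a
closed immersion of an integral scheme, `φ` the graded coefficient map, `g = Proj φ`, `Y = g(ι(H))`. GIVEN a level-0 step `(C₁, τ₁)`
out of `(ℙⁿ_O, 𝟙, Y)` and a level-1 step `(C₂, τ₂)` out of `(X₁, τ₁, S₁)` with the five HorizChainE1 step clauses each, the multisection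
device (MS), and point-resolvability of a scheme `Γ ≅ V(closure S₂)_red`, the `∃ (P′, σ, S′)` body of the EL♮ item holds for `Y`:
item E1-chain ∧ irreducible special fibre ∧ regular `V(closure S′)_red`. [folklore; assembly] -/
theorem elNatBody_of_twoSteps_pointResolvable (O : Type) [CommRing O] [IsDomain O] [IsDiscreteValuationRing O]
    (k : Type) [Field k] (π : O →+* k) (hπ : Function.Surjective π) (n : ℕ) (H : Scheme.{0})
    (ι : H ⟶ Proj (homogeneousSubmodule (Fin (n + 1)) k)) [IsClosedImmersion ι] [IsIntegral H]
    (φ : homogeneousSubmodule (Fin (n + 1)) O →+*ᵍ homogeneousSubmodule (Fin (n + 1)) k)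
    (hφ' : HomogeneousIdeal.irrelevant (homogeneousSubmodule (Fin (n + 1)) k) ≤
      (HomogeneousIdeal.irrelevant (homogeneousSubmodule (Fin (n + 1)) O)).map φ)
    (hφ : ∀ s, φ s = MvPolynomial.map π s)
    -- step 1 (level 0) out of `(ℙⁿ_O, 𝟙, Y)`
    (C₁ : (Proj (homogeneousSubmodule (Fin (n + 1)) O)).IdealSheafData) (X₁ : Scheme.{0})
    (τ₁ : X₁ ⟶ Proj (homogeneousSubmodule (Fin (n + 1)) O)) (hτ₁ : IsBlowup τ₁ C₁) (hC₁reg : Scheme.IsRegular C₁.subscheme)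
    (hC₁flat : Flat (C₁.subschemeι ≫ 𝟙 _ ≫ (Proj.toSpecZero (homogeneousSubmodule (Fin (n + 1)) O) ≫
      Spec.map (CommRingCat.ofHom (algebraMap O (homogeneousSubmodule (Fin (n + 1)) O 0))))))
    (hC₁gen : (𝟙 (Proj (homogeneousSubmodule (Fin (n + 1)) O)) : _ ⟶ _) '' (C₁.support : Set _) ⊆
      {x | ¬ IsGenericPoint x (Set.range (ι ≫ Proj.map φ hφ'))})
    (hC₁E1 : (C₁.support : Set _) ∩ (𝟙 (Proj (homogeneousSubmodule (Fin (n + 1)) O)) ≫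
      (Proj.toSpecZero (homogeneousSubmodule (Fin (n + 1)) O) ≫
        Spec.map (CommRingCat.ofHom (algebraMap O (homogeneousSubmodule (Fin (n + 1)) O 0))))) ⁻¹'
        {IsLocalRing.closedPoint O} ⊆ Set.range (ι ≫ Proj.map φ hφ'))
    -- step 2 (level 1) out of `(X₁, τ₁, S₁)`
    (C₂ : X₁.IdealSheafData) (X₂ : Scheme.{0}) (τ₂ : X₂ ⟶ X₁) (hτ₂ : IsBlowup τ₂ C₂) (hC₂reg : Scheme.IsRegular C₂.subscheme)
    (hC₂flat : Flat (C₂.subschemeι ≫ τ₁ ≫ (Proj.toSpecZero (homogeneousSubmodule (Fin (n + 1)) O) ≫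
      Spec.map (CommRingCat.ofHom (algebraMap O (homogeneousSubmodule (Fin (n + 1)) O 0))))))
    (hC₂gen : τ₁ '' (C₂.support : Set X₁) ⊆ {x | ¬ IsGenericPoint x (Set.range (ι ≫ Proj.map φ hφ'))})
    (hC₂E1 : (C₂.support : Set X₁) ∩ (τ₁ ≫ (Proj.toSpecZero (homogeneousSubmodule (Fin (n + 1)) O) ≫
      Spec.map (CommRingCat.ofHom (algebraMap O (homogeneousSubmodule (Fin (n + 1)) O 0))))) ⁻¹'
        {IsLocalRing.closedPoint O} ⊆
      closure (τ₁ ⁻¹' (Set.range (ι ≫ Proj.map φ hφ') \ (C₁.support : Set _))))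
    -- the multisection device
    (Adm : ∀ Γ : Scheme.{0}, Γ → Prop)
    (hAdm : ∀ (Γ Γ' : Scheme.{0}) (e : Γ ≅ Γ') (x : Γ), Adm Γ x → Adm Γ' (e.hom x))
    (hMS : ∀ (X' : Scheme.{0}) (σ' : X' ⟶ Proj (homogeneousSubmodule (Fin (n + 1)) O)) (S' : Set X'),
      (∀ Q : (∀ X' : Scheme.{0}, (X' ⟶ Proj (homogeneousSubmodule (Fin (n + 1)) O)) → Set X' → Prop),
        Q (Proj (homogeneousSubmodule (Fin (n + 1)) O)) (𝟙 _) (Set.range (ι ≫ Proj.map φ hφ')) →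
        (∀ (X' X'' : Scheme.{0}) (σ' : X' ⟶ Proj (homogeneousSubmodule (Fin (n + 1)) O)) (Y' : Set X')
          (C : X'.IdealSheafData) (τ : X'' ⟶ X'),
          Q X' σ' Y' → IsBlowup τ C → Scheme.IsRegular C.subscheme →
          Flat (C.subschemeι ≫ σ' ≫ (Proj.toSpecZero (homogeneousSubmodule (Fin (n + 1)) O) ≫
            Spec.map (CommRingCat.ofHom (algebraMap O (homogeneousSubmodule (Fin (n + 1)) O 0))))) →
          σ' '' (C.support : Set X') ⊆ {x | ¬ IsGenericPoint x (Set.range (ι ≫ Proj.map φ hφ'))} →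
          (C.support : Set X') ∩ (σ' ≫ (Proj.toSpecZero (homogeneousSubmodule (Fin (n + 1)) O) ≫
            Spec.map (CommRingCat.ofHom (algebraMap O (homogeneousSubmodule (Fin (n + 1)) O 0))))) ⁻¹'
            {IsLocalRing.closedPoint O} ⊆ Y' →
          Q X'' (τ ≫ σ') (closure (τ ⁻¹' (Y' \ (C.support : Set X'))))) → Q X' σ' S') →
      IsLocallyNoetherian X' → Scheme.IsRegular X' →
      IsProper (σ' ≫ (Proj.toSpecZero (homogeneousSubmodule (Fin (n + 1)) O) ≫
        Spec.map (CommRingCat.ofHom (algebraMap O (homogeneousSubmodule (Fin (n + 1)) O 0))))) →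
      ∀ (z : ↥(vanishingIdeal (⟨closure S', isClosed_closure⟩ : Closeds X')).subscheme),
        IsClosed ({((vanishingIdeal (⟨closure S', isClosed_closure⟩ : Closeds X')).subschemeι z : X')} : Set X') →
        ¬ IsRegularLocalRing ((vanishingIdeal (⟨closure S', isClosed_closure⟩ : Closeds X')).subscheme.presheaf.stalk z) →
        Adm _ z →
        ∃ C : X'.IdealSheafData, Scheme.IsRegular C.subscheme ∧
          Flat (C.subschemeι ≫ σ' ≫ (Proj.toSpecZero (homogeneousSubmodule (Fin (n + 1)) O) ≫
            Spec.map (CommRingCat.ofHom (algebraMap O (homogeneousSubmodule (Fin (n + 1)) O 0))))) ∧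
          (C.support : Set X') ∩ (σ' ≫ (Proj.toSpecZero (homogeneousSubmodule (Fin (n + 1)) O) ≫
            Spec.map (CommRingCat.ofHom (algebraMap O (homogeneousSubmodule (Fin (n + 1)) O 0))))) ⁻¹'
            {IsLocalRing.closedPoint O} =
            {((vanishingIdeal (⟨closure S', isClosed_closure⟩ : Closeds X')).subschemeι z : X')} ∧
          ∃ hzc : IsClosed ({z} : Set ↥(vanishingIdeal (⟨closure S', isClosed_closure⟩ : Closeds X')).subscheme),
            C.comap (vanishingIdeal (⟨closure S', isClosed_closure⟩ : Closeds X')).subschemeι = vanishingIdeal ⟨{z}, hzc⟩)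
    -- the downstairs scheme after the two steps and its point-resolvability
    (Γ : Scheme.{0})
    (e : Γ ≅ (vanishingIdeal (⟨closure (closure (τ₂ ⁻¹' (closure (τ₁ ⁻¹' (Set.range (ι ≫ Proj.map φ hφ') \
      (C₁.support : Set _))) \ (C₂.support : Set X₁)))), isClosed_closure⟩ : Closeds X₂)).subscheme)
    (hres : ∃ Γs : Scheme.{0}, (∀ R : Scheme.{0} → Prop, R Γ →
      (∀ (Γ₁ Γ₂ : Scheme.{0}) (x : Γ₁) (hx : IsClosed ({x} : Set Γ₁)) (υ : Γ₂ ⟶ Γ₁), R Γ₁ →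
        ¬ IsRegularLocalRing (Γ₁.presheaf.stalk x) → Adm Γ₁ x → IsBlowup υ (vanishingIdeal ⟨{x}, hx⟩) → R Γ₂) → R Γs) ∧
      Scheme.IsRegular Γs) :
    ∀ Y : Set (Proj (homogeneousSubmodule (Fin (n + 1)) O)), Y = Set.range (ι ≫ Proj.map φ hφ') →
    ∃ (P' : Scheme.{0}) (σ : P' ⟶ Proj (homogeneousSubmodule (Fin (n + 1)) O)) (S' : Set P'),
      (∀ Q : (∀ X' : Scheme.{0}, (X' ⟶ Proj (homogeneousSubmodule (Fin (n + 1)) O)) → Set X' → Prop),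
        Q (Proj (homogeneousSubmodule (Fin (n + 1)) O)) (𝟙 _) Y →
        (∀ (X' X'' : Scheme.{0}) (σ' : X' ⟶ Proj (homogeneousSubmodule (Fin (n + 1)) O)) (Y' : Set X')
          (C : X'.IdealSheafData) (τ : X'' ⟶ X'), Q X' σ' Y' → IsBlowup τ C → Scheme.IsRegular C.subscheme →
          σ' '' (C.support : Set X') ⊆ {x | ¬ IsGenericPoint x Y} →
          (C.support : Set X') ∩ (σ' ≫ (Proj.toSpecZero (homogeneousSubmodule (Fin (n + 1)) O) ≫
            Spec.map (CommRingCat.ofHom (algebraMap O (homogeneousSubmodule (Fin (n + 1)) O 0))))) ⁻¹'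
            {IsLocalRing.closedPoint O} ⊆ Y' →
          Q X'' (τ ≫ σ') (closure (τ ⁻¹' (Y' \ (C.support : Set X'))))) → Q P' σ S') ∧
      IsIrreducible ((σ ≫ (Proj.toSpecZero (homogeneousSubmodule (Fin (n + 1)) O) ≫
        Spec.map (CommRingCat.ofHom (algebraMap O (homogeneousSubmodule (Fin (n + 1)) O 0))))) ⁻¹'
        {IsLocalRing.closedPoint O}) ∧
      Scheme.IsRegular (vanishingIdeal (⟨closure S', isClosed_closure⟩ : Closeds P')).subscheme := by
  classical
  set q : (Proj (homogeneousSubmodule (Fin (n + 1)) O)) ⟶ Spec (.of O) := Proj.toSpecZero (homogeneousSubmodule (Fin (n + 1)) O) ≫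
    Spec.map (CommRingCat.ofHom (algebraMap O (homogeneousSubmodule (Fin (n + 1)) O 0))) with hqdef
  set g : Proj (homogeneousSubmodule (Fin (n + 1)) k) ⟶ (Proj (homogeneousSubmodule (Fin (n + 1)) O)) := Proj.map φ hφ' with hgdef
  intro Y hY
  subst hY
  -- the special fibre is the range of the closed immersion `g`
  have hP := ProjectiveAmbientFibre.isPullback_projMap π φ hφ hπ hφ'
  haveI : IsClosedImmersion (Spec.map (CommRingCat.ofHom π)) := IsClosedImmersion.spec_of_surjective _ hπ
  haveI : IsClosedImmersion g := MorphismProperty.IsStableUnderBaseChange.of_isPullback hP.flip inferInstance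
  have hpt : ∀ x : Spec (.of k), Spec.map (CommRingCat.ofHom π) x = IsLocalRing.closedPoint O := by
    intro x
    rw [Spec.map_apply]
    apply PrimeSpectrum.ext
    rw [PrimeSpectrum.comap_asIdeal, CommRingCat.hom_ofHom, Ideal.eq_bot_of_prime x.asIdeal, ← RingHom.ker_eq_comap_bot]
    exact IsLocalRing.eq_maximalIdeal (RingHom.ker_isMaximal_of_surjective π hπ)
  have hgq : ∀ x, q (g x) = IsLocalRing.closedPoint O := fun x ↦
    (Scheme.Hom.comp_apply g q x).symm.trans
      ((congrArg (fun h : Proj (homogeneousSubmodule (Fin (n + 1)) k) ⟶ Spec (.of O) ↦ h x) hP.w).trans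
        ((Scheme.Hom.comp_apply _ _ x).trans (hpt _)))
  -- the closed immersion `f = ι ≫ g` and its range `Y`
  let f : H ⟶ (Proj (homogeneousSubmodule (Fin (n + 1)) O)) := ι ≫ g
  let Yc : Closeds (Proj (homogeneousSubmodule (Fin (n + 1)) O)) := ⟨Set.range f, f.isClosedEmbedding.isClosed_range⟩
  have hYc : (Yc : Set (Proj (homogeneousSubmodule (Fin (n + 1)) O))) = Set.range (ι ≫ g) := rfl
  have hYs : (Yc : Set (Proj (homogeneousSubmodule (Fin (n + 1)) O))) ⊆ q ⁻¹' {IsLocalRing.closedPoint O} := by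
    rintro _ ⟨x, rfl⟩
    show q (f x) = IsLocalRing.closedPoint O
    rw [show f x = g (ι x) from Scheme.Hom.comp_apply _ _ x]
    exact hgq (ι x)
  have hYirr : IsIrreducible (Yc : Set (Proj (homogeneousSubmodule (Fin (n + 1)) O))) := by
    have h := (IrreducibleSpace.isIrreducible_univ H).image f f.continuous.continuousOn
    rwa [Set.image_univ] at h
  obtain ⟨hsm, hprop⟩ := stub_projectiveAmbientSmoothProper O n
  have hint := isIntegral_pullback_projectiveSpace_residue O n
  -- two steps and the tail
  obtain ⟨P', σ, S', hChF, hregF⟩ := horizChainE1_of_twoSteps_pointResolvable O _ q Yc hsm hprop hYs hYirr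
    C₁ X₁ τ₁ hτ₁ hC₁reg hC₁flat hC₁gen hC₁E1 C₂ X₂ τ₂ hτ₂ hC₂reg hC₂flat hC₂gen hC₂E1 Adm hAdm hMS Γ e hres
  -- horizontal E1 chain ⇒ item E1-chain and irreducible special fibre
  obtain ⟨hchain, hirr⟩ := natChain_and_isIrreducible_of_horizChainE1 O _ P' q (Yc : Set _) σ S' hsm hprop hint hYirr
    Yc.isClosed hYs hChF
  exact ⟨P', σ, S', hchain, hirr, hregF⟩

/-! ## rev 2 — EMPTY TAIL: the two explicit steps already resolve (no multisection device needed) -/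

/-- **T-Δ-ISO with EMPTY tail, general base**: two explicit horizontal E1 steps whose second reduced strict transform is REGULAR
give a horizontal-E1 stage with regular reduced strict transform (first specimens: T-ISO-1 quartic, `H_F`). [folklore] -/
theorem horizChainE1_of_twoSteps_regular (O : Type) [CommRing O] [IsLocalRing O] (P : Scheme.{0}) (q : P ⟶ Spec (.of O)) (Y : Set P)
    (C₁ : P.IdealSheafData) (X₁ : Scheme.{0}) (τ₁ : X₁ ⟶ P) (hτ₁ : IsBlowup τ₁ C₁) (hC₁reg : Scheme.IsRegular C₁.subscheme)
    (hC₁flat : Flat (C₁.subschemeι ≫ 𝟙 P ≫ q))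
    (hC₁gen : (𝟙 P : P ⟶ P) '' (C₁.support : Set P) ⊆ {x : P | ¬ IsGenericPoint x Y})
    (hC₁E1 : (C₁.support : Set P) ∩ (𝟙 P ≫ q) ⁻¹' {IsLocalRing.closedPoint O} ⊆ Y)
    (C₂ : X₁.IdealSheafData) (X₂ : Scheme.{0}) (τ₂ : X₂ ⟶ X₁) (hτ₂ : IsBlowup τ₂ C₂) (hC₂reg : Scheme.IsRegular C₂.subscheme)
    (hC₂flat : Flat (C₂.subschemeι ≫ τ₁ ≫ q))
    (hC₂gen : τ₁ '' (C₂.support : Set X₁) ⊆ {x : P | ¬ IsGenericPoint x Y})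
    (hC₂E1 : (C₂.support : Set X₁) ∩ (τ₁ ≫ q) ⁻¹' {IsLocalRing.closedPoint O} ⊆ closure (τ₁ ⁻¹' (Y \ (C₁.support : Set P))))
    (hreg : Scheme.IsRegular (vanishingIdeal (⟨closure (closure (τ₂ ⁻¹' (closure (τ₁ ⁻¹' (Y \ (C₁.support : Set P))) \
      (C₂.support : Set X₁)))), isClosed_closure⟩ : Closeds X₂)).subscheme) :
    ∃ (P' : Scheme.{0}) (σ : P' ⟶ P) (S' : Set P'),
      (∀ Q : (∀ X' : Scheme.{0}, (X' ⟶ P) → Set X' → Prop), Q P (𝟙 P) Y →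
        (∀ (X' X'' : Scheme.{0}) (σ' : X' ⟶ P) (Y' : Set X') (C : X'.IdealSheafData) (τ : X'' ⟶ X'),
          Q X' σ' Y' → IsBlowup τ C → Scheme.IsRegular C.subscheme → Flat (C.subschemeι ≫ σ' ≫ q) →
          σ' '' (C.support : Set X') ⊆ {x | ¬ IsGenericPoint x Y} →
          (C.support : Set X') ∩ (σ' ≫ q) ⁻¹' {IsLocalRing.closedPoint O} ⊆ Y' →
          Q X'' (τ ≫ σ') (closure (τ ⁻¹' (Y' \ (C.support : Set X'))))) → Q P' σ S') ∧
      Scheme.IsRegular (vanishingIdeal (⟨closure S', isClosed_closure⟩ : Closeds P')).subscheme := by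
  have hch : ∀ Q : (∀ X' : Scheme.{0}, (X' ⟶ P) → Set X' → Prop), Q P (𝟙 P) Y →
      (∀ (X' X'' : Scheme.{0}) (σ' : X' ⟶ P) (Y' : Set X') (C : X'.IdealSheafData) (τ : X'' ⟶ X'),
        Q X' σ' Y' → IsBlowup τ C → Scheme.IsRegular C.subscheme → Flat (C.subschemeι ≫ σ' ≫ q) →
        σ' '' (C.support : Set X') ⊆ {x | ¬ IsGenericPoint x Y} →
        (C.support : Set X') ∩ (σ' ≫ q) ⁻¹' {IsLocalRing.closedPoint O} ⊆ Y' →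
        Q X'' (τ ≫ σ') (closure (τ ⁻¹' (Y' \ (C.support : Set X'))))) →
      Q X₂ (τ₂ ≫ τ₁) (closure (τ₂ ⁻¹' (closure (τ₁ ⁻¹' (Y \ (C₁.support : Set P))) \ (C₂.support : Set X₁)))) := by
    intro Q h0 hs
    have h1 : Q X₁ (τ₁ ≫ 𝟙 P) (closure (τ₁ ⁻¹' (Y \ (C₁.support : Set P)))) :=
      hs P X₁ (𝟙 P) Y C₁ τ₁ h0 hτ₁ hC₁reg hC₁flat hC₁gen hC₁E1
    rw [Category.comp_id] at h1
    exact hs X₁ X₂ τ₁ _ C₂ τ₂ h1 hτ₂ hC₂reg hC₂flat hC₂gen hC₂E1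
  exact ⟨X₂, τ₂ ≫ τ₁, closure (τ₂ ⁻¹' (closure (τ₁ ⁻¹' (Y \ (C₁.support : Set P))) \ (C₂.support : Set X₁))), hch, hreg⟩

/-- **RUNG T-Δ-ISO WITH EMPTY TAIL, `q`-spelling** (the shape the quartic / `H_F` specimens consume): two explicit horizontal E1 steps
out of `(ℙⁿ_O, 𝟙, Y)` and `(X₁, τ₁, S₁)` with REGULAR second reduced strict transform ⟹ the `∃ (P′, σ, S′)` body of the EL♮ item
(item E1-chain ∧ irreducible special fibre ∧ regular `V(closure S′)_red`). [folklore; assembly] -/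
theorem elNatBody_of_twoSteps_regular (O : Type) [CommRing O] [IsDomain O] [IsDiscreteValuationRing O]
    (k : Type) [Field k] (π : O →+* k) (hπ : Function.Surjective π) (n : ℕ) (H : Scheme.{0})
    (ι : H ⟶ Proj (homogeneousSubmodule (Fin (n + 1)) k)) [IsClosedImmersion ι] [IsIntegral H]
    (φ : homogeneousSubmodule (Fin (n + 1)) O →+*ᵍ homogeneousSubmodule (Fin (n + 1)) k)
    (hφ' : HomogeneousIdeal.irrelevant (homogeneousSubmodule (Fin (n + 1)) k) ≤
      (HomogeneousIdeal.irrelevant (homogeneousSubmodule (Fin (n + 1)) O)).map φ)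
    (hφ : ∀ s, φ s = MvPolynomial.map π s)
    -- step 1 (level 0) out of `(ℙⁿ_O, 𝟙, Y)`
    (C₁ : (Proj (homogeneousSubmodule (Fin (n + 1)) O)).IdealSheafData) (X₁ : Scheme.{0})
    (τ₁ : X₁ ⟶ Proj (homogeneousSubmodule (Fin (n + 1)) O)) (hτ₁ : IsBlowup τ₁ C₁) (hC₁reg : Scheme.IsRegular C₁.subscheme)
    (hC₁flat : Flat (C₁.subschemeι ≫ 𝟙 _ ≫ (Proj.toSpecZero (homogeneousSubmodule (Fin (n + 1)) O) ≫
      Spec.map (CommRingCat.ofHom (algebraMap O (homogeneousSubmodule (Fin (n + 1)) O 0))))))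
    (hC₁gen : (𝟙 (Proj (homogeneousSubmodule (Fin (n + 1)) O)) : _ ⟶ _) '' (C₁.support : Set _) ⊆
      {x | ¬ IsGenericPoint x (Set.range (ι ≫ Proj.map φ hφ'))})
    (hC₁E1 : (C₁.support : Set _) ∩ (𝟙 (Proj (homogeneousSubmodule (Fin (n + 1)) O)) ≫
      (Proj.toSpecZero (homogeneousSubmodule (Fin (n + 1)) O) ≫
        Spec.map (CommRingCat.ofHom (algebraMap O (homogeneousSubmodule (Fin (n + 1)) O 0))))) ⁻¹'
        {IsLocalRing.closedPoint O} ⊆ Set.range (ι ≫ Proj.map φ hφ'))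
    -- step 2 (level 1) out of `(X₁, τ₁, S₁)`
    (C₂ : X₁.IdealSheafData) (X₂ : Scheme.{0}) (τ₂ : X₂ ⟶ X₁) (hτ₂ : IsBlowup τ₂ C₂) (hC₂reg : Scheme.IsRegular C₂.subscheme)
    (hC₂flat : Flat (C₂.subschemeι ≫ τ₁ ≫ (Proj.toSpecZero (homogeneousSubmodule (Fin (n + 1)) O) ≫
      Spec.map (CommRingCat.ofHom (algebraMap O (homogeneousSubmodule (Fin (n + 1)) O 0))))))
    (hC₂gen : τ₁ '' (C₂.support : Set X₁) ⊆ {x | ¬ IsGenericPoint x (Set.range (ι ≫ Proj.map φ hφ'))})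
    (hC₂E1 : (C₂.support : Set X₁) ∩ (τ₁ ≫ (Proj.toSpecZero (homogeneousSubmodule (Fin (n + 1)) O) ≫
      Spec.map (CommRingCat.ofHom (algebraMap O (homogeneousSubmodule (Fin (n + 1)) O 0))))) ⁻¹'
        {IsLocalRing.closedPoint O} ⊆
      closure (τ₁ ⁻¹' (Set.range (ι ≫ Proj.map φ hφ') \ (C₁.support : Set _))))
    -- the end: the second reduced strict transform is regular
    (hreg : Scheme.IsRegular (vanishingIdeal (⟨closure (closure (τ₂ ⁻¹' (closure (τ₁ ⁻¹' (Set.range (ι ≫ Proj.map φ hφ') \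
      (C₁.support : Set _))) \ (C₂.support : Set X₁)))), isClosed_closure⟩ : Closeds X₂)).subscheme) :
    ∀ Y : Set (Proj (homogeneousSubmodule (Fin (n + 1)) O)), Y = Set.range (ι ≫ Proj.map φ hφ') →
    ∃ (P' : Scheme.{0}) (σ : P' ⟶ Proj (homogeneousSubmodule (Fin (n + 1)) O)) (S' : Set P'),
      (∀ Q : (∀ X' : Scheme.{0}, (X' ⟶ Proj (homogeneousSubmodule (Fin (n + 1)) O)) → Set X' → Prop),
        Q (Proj (homogeneousSubmodule (Fin (n + 1)) O)) (𝟙 _) Y →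
        (∀ (X' X'' : Scheme.{0}) (σ' : X' ⟶ Proj (homogeneousSubmodule (Fin (n + 1)) O)) (Y' : Set X')
          (C : X'.IdealSheafData) (τ : X'' ⟶ X'), Q X' σ' Y' → IsBlowup τ C → Scheme.IsRegular C.subscheme →
          σ' '' (C.support : Set X') ⊆ {x | ¬ IsGenericPoint x Y} →
          (C.support : Set X') ∩ (σ' ≫ (Proj.toSpecZero (homogeneousSubmodule (Fin (n + 1)) O) ≫
            Spec.map (CommRingCat.ofHom (algebraMap O (homogeneousSubmodule (Fin (n + 1)) O 0))))) ⁻¹'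
            {IsLocalRing.closedPoint O} ⊆ Y' →
          Q X'' (τ ≫ σ') (closure (τ ⁻¹' (Y' \ (C.support : Set X'))))) → Q P' σ S') ∧
      IsIrreducible ((σ ≫ (Proj.toSpecZero (homogeneousSubmodule (Fin (n + 1)) O) ≫
        Spec.map (CommRingCat.ofHom (algebraMap O (homogeneousSubmodule (Fin (n + 1)) O 0))))) ⁻¹'
        {IsLocalRing.closedPoint O}) ∧
      Scheme.IsRegular (vanishingIdeal (⟨closure S', isClosed_closure⟩ : Closeds P')).subscheme := by
  classical
  set q : (Proj (homogeneousSubmodule (Fin (n + 1)) O)) ⟶ Spec (.of O) := Proj.toSpecZero (homogeneousSubmodule (Fin (n + 1)) O) ≫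
    Spec.map (CommRingCat.ofHom (algebraMap O (homogeneousSubmodule (Fin (n + 1)) O 0))) with hqdef
  set g : Proj (homogeneousSubmodule (Fin (n + 1)) k) ⟶ (Proj (homogeneousSubmodule (Fin (n + 1)) O)) := Proj.map φ hφ' with hgdef
  intro Y hY
  subst hY
  have hP := ProjectiveAmbientFibre.isPullback_projMap π φ hφ hπ hφ'
  haveI : IsClosedImmersion (Spec.map (CommRingCat.ofHom π)) := IsClosedImmersion.spec_of_surjective _ hπ
  haveI : IsClosedImmersion g := MorphismProperty.IsStableUnderBaseChange.of_isPullback hP.flip inferInstance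
  have hpt : ∀ x : Spec (.of k), Spec.map (CommRingCat.ofHom π) x = IsLocalRing.closedPoint O :=
    LinearCentre.specMap_apply_eq_closedPoint π hπ
  have hgq : ∀ x, q (g x) = IsLocalRing.closedPoint O := fun x ↦
    (Scheme.Hom.comp_apply g q x).symm.trans
      ((congrArg (fun h : Proj (homogeneousSubmodule (Fin (n + 1)) k) ⟶ Spec (.of O) ↦ h x) hP.w).trans
        ((Scheme.Hom.comp_apply _ _ x).trans (hpt _)))
  let f : H ⟶ (Proj (homogeneousSubmodule (Fin (n + 1)) O)) := ι ≫ g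
  have hYcl : IsClosed (Set.range (ι ≫ g)) := f.isClosedEmbedding.isClosed_range
  have hYs : Set.range (ι ≫ g) ⊆ q ⁻¹' {IsLocalRing.closedPoint O} := by
    rintro _ ⟨x, rfl⟩
    exact (congrArg q (Scheme.Hom.comp_apply ι g x)).trans (hgq (ι x))
  have hYirr : IsIrreducible (Set.range (ι ≫ g)) := by
    simpa only [Set.image_univ] using (IrreducibleSpace.isIrreducible_univ H).image f f.continuous.continuousOn
  obtain ⟨hsm, hprop⟩ := stub_projectiveAmbientSmoothProper O n
  obtain ⟨P', σ, S', hChF, hregF⟩ := horizChainE1_of_twoSteps_regular O _ q (Set.range (ι ≫ g))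
    C₁ X₁ τ₁ hτ₁ hC₁reg hC₁flat hC₁gen hC₁E1 C₂ X₂ τ₂ hτ₂ hC₂reg hC₂flat hC₂gen hC₂E1 hreg
  obtain ⟨hchain, hirr⟩ := natChain_and_isIrreducible_of_horizChainE1 O _ P' q (Set.range (ι ≫ g)) σ S' hsm hprop
    (isIntegral_pullback_projectiveSpace_residue O n) hYirr hYcl hYs hChF
  exact ⟨P', σ, S', hchain, hirr, hregF⟩

end Summit.ResolutionOfSingularities.ResolutionOfSingularities.Cruxes.EquisingularLiftNat.Sections

end
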